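import Mathlib

/-!
# T6N5TateTwist — the s-parametrised twisting law of the local ε-factor, derived from Tate's printed
(3.2.2)–(3.2.3), carrier-free

Tier 6 (README §10), sub-step N5 of the M2 discharge (t6-p7).  TIER5 §N5.5(d) and §G S3 use the
twisting law in the form ε(s, χ, ψ_a) = χ(a)|a|^{s−½} ε(s, χ, ψ).  t6-lit's finding F9 (T6-LIT-SOURCES
card C39): that form is NOT what Tate prints — Tate, «Number theoretic background», PSPUM 33-2 (1979)
p. 13 prints, in the normalisation ε(χ, ψ, dx) of the local functional equation (3.2.1),

    (3.2.2)  ε(χ, ψ, r dx) = r ε(χ, ψ, dx)            for r > 0,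
    (3.2.3)  ε(χ, ψ(ax), dx) = χ(a) ‖a‖^{−1} ε(χ, ψ, dx)   for a ∈ F^×.

The s-form is the self-dual-measure, s-parametrised convention: with dx_ψ the Haar measure self-dual
for ψ one has dx_{ψ_a} = ‖a‖^{1/2} dx_ψ, and ε(s, χ, ψ) := ε(χ ω_s, ψ, dx_ψ) where ω_s = ‖·‖^s; then

    ε(s, χ, ψ_a) = ε(χω_s, ψ_a, ‖a‖^{1/2} dx_ψ)                     (definition, dx_{ψ_a})
                 = ‖a‖^{1/2} ε(χω_s, ψ_a, dx_ψ)                      ((3.2.2))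
                 = ‖a‖^{1/2} (χω_s)(a) ‖a‖^{−1} ε(χω_s, ψ, dx_ψ)      ((3.2.3))
                 = χ(a) ‖a‖^{s − 1/2} ε(s, χ, ψ).

This file is that three-line derivation over abstract carriers: `eps : Char → Psi → Meas → ℂ` with
the two printed rules as HYPOTHESES (the M2 display `Hyp.Tate1979_3_2_2_3` delivers them), the
multiplicative structure of the characters (`mulChar`, `omega s`), the twist `tw ψ a` = ψ(a·), the
self-dual measure `sd ψ` with its scaling rule, and `nrm a` = ‖a‖ > 0.  Nothing analytic is defined.
At s = ½ the law reads ε(½, χ, ψ_a) = χ(a) ε(½, χ, ψ) — the form N5.5(d) consumes (with χ|_{F^×} = η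
it becomes the sign change by η_v(c) of both sides of (b)).

§8(d): uses an L-value-free non-vanishing device: NO.
-/

namespace Summit.Ventures.HodgeRepro2.T6.N5TateTwist

/-- The abstract data of Tate's §3.2: characters of F^× (a group `Char` with the evaluation `ev`),
the unramified characters `omega s` = ‖·‖^s, additive characters `Psi` with the twist `tw ψ a` =
ψ(a ·), Haar measures `Meas` with positive scaling `sc`, the self-dual measure `sd ψ`, the absolute
value `nrm`, and the ε-factor `eps χ ψ dx` in Tate's normalisation. -/
structure TateData (F Char Psi Meas : Type*) [Mul Char] where
  /-- χ ↦ χ(a). -/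
  ev : Char → F → ℂ
  /-- the unramified character ω_s = ‖·‖^s. -/
  omega : ℂ → Char
  /-- ‖a‖ as a real number. -/
  nrm : F → ℝ
  /-- ψ_a = ψ(a ·). -/
  tw : Psi → F → Psi
  /-- r · dx for r > 0. -/
  sc : ℝ → Meas → Meas
  /-- the Haar measure self-dual for ψ. -/
  sd : Psi → Meas
  /-- Tate's ε(χ, ψ, dx). -/
  eps : Char → Psi → Meas → ℂ

namespace TateData

variable {F Char Psi Meas : Type*} [Mul Char] (T : TateData F Char Psi Meas)

/-- The s-parametrised ε-factor: ε(s, χ, ψ) := ε(χ ω_s, ψ, dx_ψ). -/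
def epsS (s : ℂ) (χ : Char) (ψ : Psi) : ℂ := T.eps (χ * T.omega s) ψ (T.sd ψ)

/-- The hypotheses the derivation uses, each a printed rule or a convention of the normalisation
(TIER5 / t6-lit C39): (3.2.2), (3.2.3), multiplicativity of the evaluation, ω_s(a) = ‖a‖^s (as a
complex power of the positive real ‖a‖), ‖a‖ > 0 on F^×, and dx_{ψ_a} = ‖a‖^{1/2} dx_ψ. -/
structure Rules (nonzero : F → Prop) : Prop where
  /-- (3.2.2) ε(χ, ψ, r dx) = r ε(χ, ψ, dx) for r > 0. -/
  scale : ∀ χ ψ dx (r : ℝ), 0 < r → T.eps χ ψ (T.sc r dx) = r * T.eps χ ψ dx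
  /-- (3.2.3) ε(χ, ψ(ax), dx) = χ(a) ‖a‖⁻¹ ε(χ, ψ, dx) for a ∈ F^×. -/
  twist : ∀ χ ψ dx a, nonzero a → T.eps χ (T.tw ψ a) dx = T.ev χ a * (T.nrm a : ℂ)⁻¹ * T.eps χ ψ dx
  /-- (χχ′)(a) = χ(a) χ′(a). -/
  ev_mul : ∀ χ χ' a, T.ev (χ * χ') a = T.ev χ a * T.ev χ' a
  /-- ω_s(a) = ‖a‖^s. -/
  ev_omega : ∀ s a, T.ev (T.omega s) a = (T.nrm a : ℂ) ^ s
  /-- ‖a‖ > 0 for a ∈ F^×. -/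
  nrm_pos : ∀ a, nonzero a → 0 < T.nrm a
  /-- the self-dual measure for ψ_a is ‖a‖^{1/2} dx_ψ. -/
  sd_tw : ∀ ψ a, T.sd (T.tw ψ a) = T.sc (Real.sqrt (T.nrm a)) (T.sd ψ)

variable {T} {nonzero : F → Prop}

/-- THE s-FORM OF THE TWISTING LAW: ε(s, χ, ψ_a) = χ(a) ‖a‖^{s − 1/2} ε(s, χ, ψ), from (3.2.2),
(3.2.3) and the self-dual-measure convention. -/
theorem epsS_tw (h : T.Rules nonzero) (s : ℂ) (χ : Char) (ψ : Psi) (a : F) (ha : nonzero a) :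
    T.epsS s χ (T.tw ψ a) = T.ev χ a * (T.nrm a : ℂ) ^ (s - 1 / 2) * T.epsS s χ ψ := by
  have hpos : 0 < T.nrm a := h.nrm_pos a ha
  have hne : (T.nrm a : ℂ) ≠ 0 := by exact_mod_cast hpos.ne'
  unfold TateData.epsS
  rw [h.sd_tw, h.scale _ _ _ _ (Real.sqrt_pos.mpr hpos), h.twist _ _ _ _ ha, h.ev_mul, h.ev_omega]
  -- ‖a‖^{1/2} · χ(a) ‖a‖^s ‖a‖⁻¹ = χ(a) ‖a‖^{s − 1/2}
  have hsqrt : ((Real.sqrt (T.nrm a) : ℝ) : ℂ) = (T.nrm a : ℂ) ^ ((1 : ℂ) / 2) := by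
    rw [Real.sqrt_eq_rpow, Complex.ofReal_cpow hpos.le]
    norm_num
  rw [hsqrt]
  have h1 : (T.nrm a : ℂ) ^ ((1 : ℂ) / 2) * ((T.nrm a : ℂ) ^ s * (T.nrm a : ℂ)⁻¹) =
      (T.nrm a : ℂ) ^ (s - 1 / 2) := by
    rw [show (T.nrm a : ℂ)⁻¹ = (T.nrm a : ℂ) ^ (-1 : ℂ) by rw [Complex.cpow_neg_one],
      ← Complex.cpow_add _ _ hne, ← Complex.cpow_add _ _ hne]
    congr 1
    ring
  calc (T.nrm a : ℂ) ^ ((1 : ℂ) / 2) * (T.ev χ a * (T.nrm a : ℂ) ^ s * (T.nrm a : ℂ)⁻¹ *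
        T.eps (χ * T.omega s) ψ (T.sd ψ))
      = T.ev χ a * ((T.nrm a : ℂ) ^ ((1 : ℂ) / 2) * ((T.nrm a : ℂ) ^ s * (T.nrm a : ℂ)⁻¹)) *
          T.eps (χ * T.omega s) ψ (T.sd ψ) := by ring
    _ = T.ev χ a * (T.nrm a : ℂ) ^ (s - 1 / 2) * T.eps (χ * T.omega s) ψ (T.sd ψ) := by rw [h1]

/-- At the centre s = ½: ε(½, χ, ψ_a) = χ(a) ε(½, χ, ψ) — the form TIER5 §N5.5(d) consumes. -/
theorem epsS_tw_half (h : T.Rules nonzero) (χ : Char) (ψ : Psi) (a : F) (ha : nonzero a) :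
    T.epsS (1 / 2) χ (T.tw ψ a) = T.ev χ a * T.epsS (1 / 2) χ ψ := by
  rw [epsS_tw h _ _ _ _ ha, sub_self, Complex.cpow_zero, mul_one]

end TateData

end Summit.Ventures.HodgeRepro2.T6.N5TateTwist
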